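import Summits.Ventures.HodgeRepro2.T5RecordSatakeSevenPrime
import Summits.Ventures.HodgeRepro2.T5CyclotomicSevenSplitPrime
import Mathlib.NumberTheory.LSeries.PrimesInAP

/-!
# Infinitely many inert and infinitely many split places of the field of record, by Dirichlet

Tier-5 support N3 / §G-N4.2 (seat p3, gen 78). Files 256–258 give, for every rational prime `p` of order `6`
(resp. `3`) modulo `7`, a place `(p)` of `ℚ(ζ₇)⁺` that stays prime in `ℚ(ζ₇)` with the record's Hecke algebra
`k[T₁]` (resp. with two places above it and a commutative record's Hecke algebra). Mathlib's Dirichlet theorem on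
primes in arithmetic progressions (`Nat.infinite_setOf_prime_and_eq_mod`, this pin) makes both families infinite:

* `infinite_setOf_prime_and_orderOf_eq_six`, `infinite_setOf_prime_and_orderOf_eq_three` — infinitely many
  primes `p ≡ 3 (mod 7)` (order `6`) and `p ≡ 2 (mod 7)` (order `3`);
* `vPrime_injective`, `vSplit_injective` — the places `(p)` are pairwise distinct (`N(v) = p³`);
* **`infinite_setOf_staysPrime`** — infinitely many places of `ℚ(ζ₇)⁺` stay prime in `ℚ(ζ₇)`;
* **`infinite_setOf_nonempty_algEquiv_polynomial`** — infinitely many places `v` of `ℚ(ζ₇)⁺` at which the record's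
  spherical Hecke algebra `H(U(1 ⊗ H₀), K_v)` is `k[X]` (for every family `l` of generators);
* **`infinite_setOf_ncard_primesOver_eq_two`** — infinitely many places of `ℚ(ζ₇)⁺` have two places of `ℚ(ζ₇)`
  above them; **`infinite_setOf_heckeAlgebra_mul_comm`** — at infinitely many of them the record's spherical Hecke
  algebra is commutative.

§8(d): uses an L-value-free non-vanishing device: NO.
-/

open NumberField NumberField.IsCMField IsDedekindDomain IsDedekindDomain.HeightOneSpectrum Module Polynomial
open scoped TensorProduct Pointwise
open Summit.Ventures.HodgeRepro2.T5UnitaryGroupForm Summit.Ventures.HodgeRepro2.T5UnitaryHeckeAdjoint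
  Summit.Ventures.HodgeRepro2.T5HeckePermutationModule Summit.Ventures.HodgeRepro2.T5RecordHyperspecial
  Summit.Ventures.HodgeRepro2.T5RecordSatakeToy Summit.Ventures.HodgeRepro2.T5SplitPlaceUnitaryGroup
  Summit.Ventures.HodgeRepro2.T5CyclotomicSevenInertThree Summit.Ventures.HodgeRepro2.T5CyclotomicSevenInertPrime
  Summit.Ventures.HodgeRepro2.T5RecordSatakeSevenPrime Summit.Ventures.HodgeRepro2.T5CyclotomicSevenSplitPrime
  Summit.Ventures.HodgeRepro2.T5FinitePlaceCM Summit.Ventures.HodgeRepro2.T5StarOfInvolution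
  Summit.Ventures.HodgeRepro2.T5NonSplitPlaceUnitaryGroup Summit.Ventures.HodgeRepro2.T5GlobalLatticeAlmostAll
  Summit.Ventures.HodgeRepro2.T5FinitePlaceSplitClassification

namespace Summit.Ventures.HodgeRepro2.T5CyclotomicSevenInfinitelyMany

section Dirichlet

/-- **Infinitely many primes of order `6` modulo `7`** (Dirichlet for the class of `3`, which has order `6`). -/
theorem infinite_setOf_prime_and_orderOf_eq_six : {p : ℕ | p.Prime ∧ orderOf (p : ZMod 7) = 6}.Infinite := by
  have hu : IsUnit ((3 : ℕ) : ZMod 7) := ⟨ZMod.unitOfCoprime 3 (by norm_num), rfl⟩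
  refine (Nat.infinite_setOf_prime_and_eq_mod hu).mono ?_
  intro p hp
  refine ⟨hp.1, ?_⟩
  rw [hp.2, Nat.cast_ofNat]
  exact orderOf_three_zmod_seven

/-- **Infinitely many primes of order `3` modulo `7`** (Dirichlet for the class of `2`, which has order `3`). -/
theorem infinite_setOf_prime_and_orderOf_eq_three : {p : ℕ | p.Prime ∧ orderOf (p : ZMod 7) = 3}.Infinite := by
  have hu : IsUnit ((2 : ℕ) : ZMod 7) := ⟨ZMod.unitOfCoprime 2 (by norm_num), rfl⟩
  refine (Nat.infinite_setOf_prime_and_eq_mod hu).mono ?_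
  intro p hp
  refine ⟨hp.1, ?_⟩
  rw [hp.2, Nat.cast_ofNat]
  exact T5CyclotomicSevenSplitTwo.orderOf_two_zmod_seven

end Dirichlet

section Seven

variable (K : Type*) [Field K] [CharZero K] [IsCyclotomicExtension {7} ℚ K]

/-- The inert places `(p)`, indexed by the primes of order `6` modulo `7`. -/
noncomputable def vPrimeOf (p : {p : ℕ // p.Prime ∧ orderOf (p : ZMod 7) = 6}) :
    HeightOneSpectrum (𝓞 (maximalRealSubfield K)) :=
  vPrime K p.1 (hp := ⟨p.2.1⟩) p.2.2

/-- The split places `(p)`, indexed by the primes of order `3` modulo `7`. -/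
noncomputable def vSplitOf (p : {p : ℕ // p.Prime ∧ orderOf (p : ZMod 7) = 3}) :
    HeightOneSpectrum (𝓞 (maximalRealSubfield K)) :=
  vSplit K p.1 (hp := ⟨p.2.1⟩) p.2.2

/-- Distinct primes give distinct inert places (`N(vPrime p) = p³`). -/
theorem vPrimeOf_injective :
    haveI := numberField' K; haveI := isCMField' K
    Function.Injective (vPrimeOf K) := by
  haveI := numberField' K
  haveI := isCMField' K
  intro p q h
  have hp := absNorm_vPrime K p.1 (hp := ⟨p.2.1⟩) p.2.2
  have hq := absNorm_vPrime K q.1 (hp := ⟨q.2.1⟩) q.2.2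
  have h' : (vPrimeOf K p).asIdeal = (vPrimeOf K q).asIdeal := by rw [h]
  have h3 : p.1 ^ 3 = q.1 ^ 3 := by
    rw [← hp, ← hq]
    exact h'.symm ▸ rfl
  exact Subtype.ext (Nat.pow_left_injective (by norm_num) h3)

/-- Distinct primes give distinct split places (`N(vSplit p) = p³`). -/
theorem vSplitOf_injective :
    haveI := numberField' K; haveI := isCMField' K
    Function.Injective (vSplitOf K) := by
  haveI := numberField' K
  haveI := isCMField' K
  intro p q h
  have hp := absNorm_vSplit K p.1 (hp := ⟨p.2.1⟩) p.2.2
  have hq := absNorm_vSplit K q.1 (hp := ⟨q.2.1⟩) q.2.2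
  have h' : (vSplitOf K p).asIdeal = (vSplitOf K q).asIdeal := by rw [h]
  have h3 : p.1 ^ 3 = q.1 ^ 3 := by
    rw [← hp, ← hq]
    exact h'.symm ▸ rfl
  exact Subtype.ext (Nat.pow_left_injective (by norm_num) h3)

/-- **Infinitely many places of `ℚ(ζ₇)⁺` stay prime in `ℚ(ζ₇)`** (`v 𝓞_K = w` for some place `w`). -/
theorem infinite_setOf_staysPrime :
    haveI := numberField' K; haveI := isCMField' K
    {v : HeightOneSpectrum (𝓞 (maximalRealSubfield K)) | ∃ w : HeightOneSpectrum (𝓞 K),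
      Ideal.map (algebraMap (𝓞 (maximalRealSubfield K)) (𝓞 K)) v.asIdeal = w.asIdeal}.Infinite := by
  haveI := numberField' K
  haveI := isCMField' K
  haveI : Infinite {p : ℕ // p.Prime ∧ orderOf (p : ZMod 7) = 6} :=
    infinite_setOf_prime_and_orderOf_eq_six.to_subtype
  exact Set.infinite_of_injective_forall_mem (vPrimeOf_injective K) fun p =>
    ⟨wPrime K p.1 (hp := ⟨p.2.1⟩) p.2.2, map_vPrime K p.1 (hp := ⟨p.2.1⟩) p.2.2⟩

/-- **At infinitely many places `v` of `ℚ(ζ₇)⁺` the record's spherical Hecke algebra `H(U(1 ⊗ H₀), K_v)` is `k[X]`**,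
for every family `l` of generators of `𝓞_{ℚ(ζ₇)}` over `𝓞_{ℚ(ζ₇)⁺}`. -/
theorem infinite_setOf_nonempty_algEquiv_polynomial (k : Type*) [Field k] :
    haveI := numberField' K; haveI := isCMField' K
    {v : HeightOneSpectrum (𝓞 (maximalRealSubfield K)) | ∀ {r : ℕ} (l : Fin r → 𝓞 K),
      Submodule.span (𝓞 (maximalRealSubfield K)) (Set.range l) = ⊤ →
      Nonempty (Polynomial k ≃ₐ[k]
        (letI := tensorStarRing K v; ↥(heckeAlgebra k (recordHyperspecial K v l (gramToy K)))))}.Infinite := by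
  haveI := numberField' K
  haveI := isCMField' K
  haveI : Infinite {p : ℕ // p.Prime ∧ orderOf (p : ZMod 7) = 6} :=
    infinite_setOf_prime_and_orderOf_eq_six.to_subtype
  exact Set.infinite_of_injective_forall_mem (vPrimeOf_injective K) fun p {r} l hl =>
    nonempty_algEquiv_polynomial_record_seven_prime K p.1 (hp := ⟨p.2.1⟩) p.2.2 k l hl

/-- **Infinitely many places of `ℚ(ζ₇)⁺` have exactly two places of `ℚ(ζ₇)` above them.** -/
theorem infinite_setOf_ncard_primesOver_eq_two :
    haveI := numberField' K; haveI := isCMField' K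
    {v : HeightOneSpectrum (𝓞 (maximalRealSubfield K)) | (v.asIdeal.primesOver (𝓞 K)).ncard = 2}.Infinite := by
  haveI := numberField' K
  haveI := isCMField' K
  haveI : Infinite {p : ℕ // p.Prime ∧ orderOf (p : ZMod 7) = 3} :=
    infinite_setOf_prime_and_orderOf_eq_three.to_subtype
  exact Set.infinite_of_injective_forall_mem (vSplitOf_injective K) fun p =>
    ncard_primesOver_vSplit K p.1 (hp := ⟨p.2.1⟩) p.2.2

/-- **At infinitely many places `v` of `ℚ(ζ₇)⁺` with two places above them, the record's spherical Hecke algebra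
`H(U(1 ⊗ H₀), K_v)` is commutative**, for every family `l` of generators. -/
theorem infinite_setOf_heckeAlgebra_mul_comm (k : Type*) [Field k] :
    haveI := numberField' K; haveI := isCMField' K
    {v : HeightOneSpectrum (𝓞 (maximalRealSubfield K)) | (v.asIdeal.primesOver (𝓞 K)).ncard = 2 ∧
      ∀ {r : ℕ} (l : Fin r → 𝓞 K), Submodule.span (𝓞 (maximalRealSubfield K)) (Set.range l) = ⊤ →
      ∀ T S : (letI := tensorStarRing K v; ↥(heckeAlgebra k (recordHyperspecial K v l (gramToy K)))),
        T * S = S * T}.Infinite := by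
  haveI := numberField' K
  haveI := isCMField' K
  haveI : Infinite {p : ℕ // p.Prime ∧ orderOf (p : ZMod 7) = 3} :=
    infinite_setOf_prime_and_orderOf_eq_three.to_subtype
  exact Set.infinite_of_injective_forall_mem (vSplitOf_injective K) fun p =>
    ⟨ncard_primesOver_vSplit K p.1 (hp := ⟨p.2.1⟩) p.2.2, fun {r} l hl T S =>
      heckeAlgebra_mul_comm_record_seven_split K p.1 (hp := ⟨p.2.1⟩) p.2.2 k l hl T S⟩

end Seven

end Summit.Ventures.HodgeRepro2.T5CyclotomicSevenInfinitelyMany
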